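import Literature.Probability.LatticeModels.RCContours
import HarnessLib

/-!
# Random-cluster contours, II: contours of a configuration, labels (FV Lemma 7.19)

Topic `Literature/Probability/LatticeModels`. Continues `RCContours`: the contour of a configuration
at one of its supports records the support, the open edges inside it and the `ord`-good sites of its
exterior `★`-boundary (`Contour`, `contourAt`, `contoursOf`; FV Def. 7.18 with the labels of Lemma
7.19 encoded as a set of boundary sites). The **label lemma** (FV Lemma 7.19, random-cluster form):
sites `★`-adjacent to a support but off it are good with a good `★`-neighbourhood, `★`-adjacent good
sites have the same type (their balls share an edge), and the interior `★`-boundary of every component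
of the complement of a support is `★`-connected (`StarComponents`, Lemma B.82); hence the type is
constant on the part of the exterior boundary of the support lying in one component
(`ordGood_iff_of_reflTransGen`), the label of that component. Consequences: the intrinsic openness
`Contour.IsOpen` of a contour (open edges inside the support, the label elsewhere) agrees with the
configuration on every edge of the ball of a site of the support (`isOpen_iff_eOpen_of_mem_supp`).

Everything is proved; no named facts.

## References

* S. Friedli, Y. Velenik, *Statistical Mechanics of Lattice Systems*, CUP 2017, §7.2.6, Def. 7.18,
  Lemma 7.19 (labels) and its proof in App. B.15. [FriedliVelenik2017]
* G. Grimmett, *The Random-Cluster Model*, Springer 2006, §7.5. [Grimmett2006]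
-/

noncomputable section

open Finset Relation

namespace Literature.Probability.LatticeModels

namespace RCC

variable {d : ℕ}

/-! ### Contours of a configuration -/

/-- **A contour**: a support `γ̄`, the open edges inside `γ̄`, and the `ord`-good sites of the
exterior `★`-boundary of `γ̄` (which encode the labels of the components of `γ̄ᶜ`, FV Lemma 7.19).
[cite: FriedliVelenik2017, §7.2.6, Def. 7.18 (γ = (γ̄, ω_γ̄)) and Lemma 7.19 (labels)] -/
structure Contour (d : ℕ) where
  /-- the support `γ̄` -/
  supp : Finset (Site d)
  /-- the open edges among the nearest-neighbour edges inside `γ̄` -/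
  openE : Finset (Sym2 (Site d))
  /-- the `ord`-good sites of `∂^ex_★ γ̄` -/
  ordB : Finset (Site d)
  deriving DecidableEq

variable (σ : Phase) (F ω : Finset (Sym2 (Site d)))

/-- **The contour of the configuration at the support `S`.** [cite: FriedliVelenik2017, §7.2.6, Def. 7.18] -/
def contourAt (S : Finset (Site d)) : Contour d :=
  ⟨S, (nnEdges S).filter fun e => EOpen σ F ω e, (exBoundary S).filter fun y => OrdGood σ F ω y⟩

/-- **The contours of a configuration.** [cite: FriedliVelenik2017, §7.2.6, Def. 7.18 (Γ(ω) = {γ̄₁,…,γ̄ₙ})] -/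
def contoursOf : Finset (Contour d) := (supports σ F ω).image (contourAt σ F ω)

/-- **Well-formed (realizable) contours**: those that are a contour of some finitary configuration
(FV: "for each contour there exists a configuration that has γ as [a] contour").
[cite: FriedliVelenik2017, §7.2.6 (𝒞^#: the collection of all possible contours)] -/
def WF (γ : Contour d) : Prop := ∃ (σ : Phase) (F ω : Finset (Sym2 (Site d))), ω ⊆ F ∧ γ ∈ contoursOf σ F ω

variable {σ F ω}

/-- The support of `contourAt`. [folklore] -/
@[simp] theorem contourAt_supp (S : Finset (Site d)) : (contourAt σ F ω S).supp = S := rfl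

/-- Membership in `contoursOf`. [folklore] -/
theorem mem_contoursOf {γ : Contour d} : γ ∈ contoursOf σ F ω ↔ ∃ S ∈ supports σ F ω, contourAt σ F ω S = γ := by
  rw [contoursOf, mem_image]

/-- The support of a contour of `ω` is a support of `ω`. [folklore] -/
theorem supp_mem_supports {γ : Contour d} (h : γ ∈ contoursOf σ F ω) : γ.supp ∈ supports σ F ω := by
  obtain ⟨S, hS, rfl⟩ := mem_contoursOf.1 h; exact hS

/-- `contourAt` is injective on supports (the support is recorded). [folklore] -/
theorem contourAt_injective : Function.Injective (contourAt σ F ω) := fun S S' h => by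
  have := congrArg Contour.supp h; simpa using this

/-- Supports of well-formed contours are non-empty and `★`-connected. [cite: FriedliVelenik2017, Def. 7.18] -/
theorem WF.supp_nonempty_starConn {γ : Contour d} (h : WF γ) : γ.supp.Nonempty ∧ StarConn (γ.supp : Set (Site d)) := by
  obtain ⟨σ, F, ω, -, hγ⟩ := h
  obtain ⟨-, h2, h3, -⟩ := support_props (supp_mem_supports hγ)
  exact ⟨h2, h3⟩

/-! ### Good sites: sharing an edge, constancy of the type along `★`-chains -/

/-- **Two `★`-adjacent sites have a common edge in their balls.** [cite: FriedliVelenik2017, §7.2.1 (remark: ★-adjacent correct sites have the same type)] -/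
theorem exists_mem_ballEdges_inter (hd : 1 ≤ d) {y y' : Site d} (h : supDist y y' ≤ 1) :
    ∃ e, e ∈ ballEdges y ∧ e ∈ ballEdges y' := by
  -- the edge from `y'` one step back towards `y` in the first coordinate (or forward if equal)
  set i : Fin d := ⟨0, hd⟩
  rw [supDist_le_iff] at h
  -- a neighbour `z` of `y'` in direction `i` inside both balls
  set z : Site d := Function.update y' i (if y i ≤ y' i then y' i - 1 else y' i + 1) with hz
  have hadj : (zdGraph d).Adj y' z := by
    refine (zdGraph_adj_iff _ _).2 ⟨i, ?_⟩
    by_cases hle : y i ≤ y' i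
    · right; funext j
      by_cases hj : j = i
      · subst hj; simp [hz, hle]
      · simp [hz, Function.update_of_ne hj, Pi.single_eq_of_ne hj]
    · left; funext j
      by_cases hj : j = i
      · subst hj; simp [hz, hle]
      · simp [hz, Function.update_of_ne hj, Pi.single_eq_of_ne hj]
  have hzy : z ∈ starBall y := by
    rw [mem_starBall, supDist_le_iff]
    intro j
    by_cases hj : j = i
    · subst hj; have := h i; simp only [hz, Function.update_self]; split_ifs <;> omega
    · rw [hz, Function.update_of_ne hj]; exact h j
  have hzy' : z ∈ starBall y' := (adj_iff_mem_starBall.1 (zdGraph_le_zdStar hadj)).1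
  have hy'y : y' ∈ starBall y := mem_starBall.2 (supDist_le_iff.2 h)
  refine ⟨s(y', z), mem_ballEdges_iff.2 ⟨(SimpleGraph.mem_edgeSet _).2 hadj, ?_⟩,
    mem_ballEdges_iff.2 ⟨(SimpleGraph.mem_edgeSet _).2 hadj, ?_⟩⟩
  · rw [coBall_mk, mem_inter, mem_starBall_comm (x := y'), mem_starBall_comm (x := z)]; exact ⟨hy'y, hzy⟩
  · rw [coBall_mk, mem_inter, mem_starBall_comm (x := z)]; exact ⟨mem_starBall_self _, hzy'⟩

/-- **`★`-adjacent good sites have the same type**: if `y` is `ord`-good and `y'` is not bad and at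
`d_∞`-distance `≤ 1`, then `y'` is `ord`-good. [cite: FriedliVelenik2017, §7.2.1] -/
theorem ordGood_of_supDist_le_one (hd : 1 ≤ d) {y y' : Site d} (h : supDist y y' ≤ 1) (hy : OrdGood σ F ω y)
    (hy' : ¬ Bad σ F ω y') : OrdGood σ F ω y' := by
  by_contra hno
  have hdis : DisGood σ F ω y' := by
    by_contra hnd; exact hy' ⟨hno, hnd⟩
  obtain ⟨e, he, he'⟩ := exists_mem_ballEdges_inter hd h
  exact hdis e he' (hy e he)

/-- **The type is constant along `★`-chains of non-bad sites.** [cite: FriedliVelenik2017, §7.2.1 and Lemma 7.19] -/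
theorem ordGood_iff_of_chain (hd : 1 ≤ d) {G : Set (Site d)} (hG : ∀ z ∈ G, ¬ Bad σ F ω z) {y y' : Site d}
    (h : ReflTransGen (starRel G) y y') : OrdGood σ F ω y ↔ OrdGood σ F ω y' := by
  induction h with
  | refl => exact Iff.rfl
  | tail _ hbc ih =>
    rw [ih]
    have h1 := (zdStar_adj.1 hbc.1).2
    exact ⟨fun hb => ordGood_of_supDist_le_one hd h1 hb (hG _ hbc.2.2),
      fun hc => ordGood_of_supDist_le_one hd (by rwa [supDist_comm]) hc (hG _ hbc.2.1)⟩

/-! ### The label lemma -/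

/-- The interior `★`-boundary of a component of the complement of a support lies in the exterior
`★`-boundary of the support. [folklore] -/
theorem inBoundary_subset_exBoundary_of_compl {S A : Finset (Site d)}
    (hA : ∀ x ∈ A, ∀ y, y ∉ S → (zdStar d).Adj x y → y ∈ A) (hAS : Disjoint A S) : inBoundary A ⊆ exBoundary S := by
  intro x hx
  obtain ⟨hxA, y, hyA, hxy⟩ := mem_inBoundary.1 hx
  have hyS : y ∈ S := by by_contra hyS; exact hyA (hA x hxA y hyS hxy)
  exact mem_exBoundary.2 ⟨Finset.disjoint_left.1 hAS hxA, y, hyS, hxy.symm⟩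

section Labels

variable (hω : ω ⊆ F) {S : Finset (Site d)} (hS : S ∈ supports σ F ω)
include hω hS

omit hω in
/-- **Sites off a support but `★`-adjacent to it are off the thick bad set.** [cite: FriedliVelenik2017, §7.2.6 (∂^ex γ̄ ⊂ Γ(ω)ᶜ)] -/
theorem not_mem_thick_of_adj {x y : Site d} (hx : x ∈ S) (hy : y ∉ S) (hxy : (zdStar d).Adj x y) : y ∉ thick σ F ω :=
  fun hyt => hy ((support_props hS).2.2.2 x hx y hyt hxy)

/-- Sites of the exterior `★`-boundary of a support are not bad, and neither are the sites of their
balls. [cite: FriedliVelenik2017, §7.2.6 and Lemma 7.19] -/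
theorem not_bad_near_exBoundary {y : Site d} (hy : y ∈ exBoundary S) {z : Site d} (hz : z ∈ starBall y) : ¬ Bad σ F ω z := by
  obtain ⟨hyS, x, hx, hxy⟩ := mem_exBoundary.1 hy
  exact not_bad_of_not_mem_thick hω (not_mem_thick_of_adj hS hx hyS hxy) hz

/-- **The label lemma, chain form (FV Lemma 7.19 for random-cluster contours)**: two sites of the
exterior `★`-boundary of a support that are chained in the complement of the support have the same
type. [cite: FriedliVelenik2017, §7.2.6, Lemma 7.19 (with App. B.15, Lemma B.82)] -/
theorem ordGood_iff_of_reflTransGen (hd : 2 ≤ d) {u u' : Site d} (hu : u ∈ exBoundary S) (hu' : u' ∈ exBoundary S)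
    (h : ReflTransGen (starRel (S : Set (Site d))ᶜ) u u') : OrdGood σ F ω u ↔ OrdGood σ F ω u' := by
  have hd1 : 1 ≤ d := by omega
  obtain ⟨-, -, hSconn, hSmax⟩ := support_props hS
  have huS : u ∉ S := (mem_exBoundary.1 hu).1
  -- the good set: all non-bad sites
  set G : Set (Site d) := {z | ¬ Bad σ F ω z} with hG
  have hGood : ∀ y ∈ exBoundary S, y ∈ G := fun y hy => not_bad_near_exBoundary hω hS hy (mem_starBall_self y)
  -- `u` is exterior or interior; `u'` lies in the same component
  rcases mem_starExt_or_mem_starInt hd huS with hue | hui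
  · -- exterior component: both in `∂^ex (hull S) = ∂^in (ext S)`, which is `★`-connected
    have hu'e : u' ∈ starExt S := mem_starExt_of_reflTransGen hue h
    have hmem : ∀ v, v ∈ exBoundary S → v ∈ starExt S → v ∈ exBoundary (starHullFinset S) := by
      intro v hv hve
      obtain ⟨hvS, x, hx, hxv⟩ := mem_exBoundary.1 hv
      exact mem_exBoundary.2 ⟨fun h' => (mem_starHullFinset hd).1 h' hve, x,
        (mem_starHullFinset hd).2 (subset_starHull S (mem_coe.2 hx)), hxv⟩
    have hconn := (starConn_boundaries_starHull hd hSconn).1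
    have hsub : (exBoundary (starHullFinset S) : Set (Site d)) ⊆ G := by
      intro v hv
      obtain ⟨hvh, x, hx, hxv⟩ := mem_exBoundary.1 (mem_coe.1 hv)
      -- `x ∈ hull`, `v ∉ hull`: then `x ∈ S` (an interior point's off-support neighbours are interior)
      have hxS : x ∈ S := by
        by_contra hxS
        have hxi : x ∈ starInt S := (mem_starInt hd).2 ⟨hxS, (mem_starHullFinset hd).1 hx⟩
        have hve : v ∈ starExt S := by
          by_contra hve
          exact hvh ((mem_starHullFinset hd).2 hve)
        have hvS : v ∉ S := fun h' => hvh ((mem_starHullFinset hd).2 (subset_starHull S (mem_coe.2 h')))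
        exact ((mem_starInt hd).1 (mem_starInt_of_reflTransGen hd hxi (ReflTransGen.single ⟨hxv, fun h' => hxS (mem_coe.1 h'),
          fun h' => hvS (mem_coe.1 h')⟩))).2 hve
      have hvS : v ∉ S := fun h' => hvh ((mem_starHullFinset hd).2 (subset_starHull S (mem_coe.2 h')))
      exact hGood v (mem_exBoundary.2 ⟨hvS, x, hxS, hxv⟩)
    have hchain := hconn u (mem_coe.2 (hmem u hu hue)) u' (mem_coe.2 (hmem u' hu' hu'e))
    exact ordGood_iff_of_chain hd1 (fun z hz => hz) (reflTransGen_starRel_mono hsub hchain)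
  · -- interior component `A` through `u`
    set A := starIntComp S u with hAdef
    have hu'A : u' ∈ A := (mem_starIntComp hd hui).2 h
    have hconn := (starConn_boundaries_starIntComp hd hSconn hui).1
    have hAmax : ∀ x ∈ A, ∀ y, y ∉ S → (zdStar d).Adj x y → y ∈ A := fun x hx y hy hxy =>
      mem_starIntComp_of_starRel hd hui hx ⟨hxy, fun h' => ((mem_starInt hd).1 (starIntComp_subset S u hx)).1 (mem_coe.1 h'),
        fun h' => hy (mem_coe.1 h')⟩
    have hAS : Disjoint A S := Finset.disjoint_left.2 fun x hx hxS => ((mem_starInt hd).1 (starIntComp_subset S u hx)).1 hxS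
    have hsub : (inBoundary A : Set (Site d)) ⊆ G := fun v hv =>
      hGood v (inBoundary_subset_exBoundary_of_compl hAmax hAS (mem_coe.1 hv))
    have hmem : ∀ v, v ∈ exBoundary S → v ∈ A → v ∈ inBoundary A := by
      intro v hv hvA
      obtain ⟨hvS, x, hx, hxv⟩ := mem_exBoundary.1 hv
      exact mem_inBoundary.2 ⟨hvA, x, Finset.disjoint_right.1 hAS hx, hxv.symm⟩
    have hchain := hconn u (mem_coe.2 (hmem u hu (mem_starIntComp_self hd hui))) u' (mem_coe.2 (hmem u' hu' hu'A))
    exact ordGood_iff_of_chain hd1 (fun z hz => hz) (reflTransGen_starRel_mono hsub hchain)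

omit hω in
/-- **Every component of the complement of a support meets the exterior boundary of the support**: from
any site off `S`, a chain in `Sᶜ` leads to a site of `∂^ex S`. [cite: FriedliVelenik2017, §7.2.6, Exercise 7.11] -/
theorem exists_exBoundary_reflTransGen {u : Site d} (hu : u ∉ S) :
    ∃ y ∈ exBoundary S, ReflTransGen (starRel (S : Set (Site d))ᶜ) u y := by
  obtain ⟨y, z, hz, hyz, huy⟩ := exists_reflTransGen_adj_of_not_mem (support_props hS).2.1 hu
  have hyS : y ∉ S := fun h => (mem_of_reflTransGen_starRel huy (fun h' => hu (mem_coe.1 h'))) (mem_coe.2 h)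
  exact ⟨y, mem_exBoundary.2 ⟨hyS, z, hz, hyz.symm⟩, huy⟩

end Labels

/-! ### The intrinsic openness of a contour and its agreement with the configuration -/

namespace Contour

/-- **The component of `u` (off the support) is `ord`-labelled**: `u` is chained in the complement of
the support to an `ord`-good exterior-boundary site. [cite: FriedliVelenik2017, §7.2.6, Lemma 7.19 (lab(A_j))] -/
def CompOrd (γ : Contour d) (u : Site d) : Prop := ∃ y ∈ γ.ordB, ReflTransGen (starRel (γ.supp : Set (Site d))ᶜ) u y

/-- **The intrinsic openness of an edge for a contour**: inside the support as recorded, elsewhere the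
label of the component of an endpoint off the support (the configuration "ω_γ̄" of FV having `γ` as its
unique contour). [cite: FriedliVelenik2017, §7.2.6 (the configuration ω_γ̄ extended by the labels)] -/
def IsOpen (γ : Contour d) (e : Sym2 (Site d)) : Prop :=
  e ∈ γ.openE ∨ (e ∉ nnEdges γ.supp ∧ ∃ u, u ∈ e ∧ u ∉ γ.supp ∧ γ.CompOrd u)

/-- **The label of a finite set of sites** (meaningful for the interior components): `ord` iff it
contains an `ord`-good exterior-boundary site. [cite: FriedliVelenik2017, §7.2.6, Lemma 7.19] -/
def lab (γ : Contour d) (A : Finset (Site d)) : Phase := by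
  classical exact if ∃ y ∈ γ.ordB, y ∈ A then Phase.ord else Phase.dis

/-- **The type of a contour**: the label of its exterior. [cite: FriedliVelenik2017, §7.2.6 (type of γ = lab(ext γ))] -/
def type (γ : Contour d) : Phase := by
  classical exact if ∃ y ∈ γ.ordB, y ∈ starExt γ.supp then Phase.ord else Phase.dis

end Contour

section Agreement

variable (hω : ω ⊆ F) {S : Finset (Site d)} (hS : S ∈ supports σ F ω)
include hω hS

/-- **`CompOrd` of the extracted contour is the type of the exterior-boundary sites of the component**:
for `u ∉ S`, the component of `u` is `ord`-labelled iff some (equivalently every) site of `∂^ex S` chained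
to `u` in `Sᶜ` is `ord`-good. [cite: FriedliVelenik2017, §7.2.6, Lemma 7.19] -/
theorem compOrd_contourAt_iff (hd : 2 ≤ d) {u : Site d} {y : Site d} (hy : y ∈ exBoundary S)
    (huy : ReflTransGen (starRel (S : Set (Site d))ᶜ) u y) : (contourAt σ F ω S).CompOrd u ↔ OrdGood σ F ω y := by
  constructor
  · rintro ⟨y', hy', huy'⟩
    rw [contourAt] at hy'
    obtain ⟨hy'b, hy'g⟩ := mem_filter.1 hy'
    have hyy' : ReflTransGen (starRel (S : Set (Site d))ᶜ) y y' := (reflTransGen_starRel_symm huy).trans huy'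
    exact (ordGood_iff_of_reflTransGen hω hS hd hy hy'b hyy').2 hy'g
  · intro hyg
    exact ⟨y, mem_filter.2 ⟨hy, hyg⟩, huy⟩

/-- For a site `u ∉ S` not bad, with all ball sites not bad... **the type of a site chained to the
boundary**: if `u ∉ S` is not in the thick bad set... Simplified statement used below: for `y ∈ ∂^ex S`,
`CompOrd y ↔ OrdGood y`. [cite: FriedliVelenik2017, §7.2.6, Lemma 7.19] -/
theorem compOrd_contourAt_iff_ordGood (hd : 2 ≤ d) {y : Site d} (hy : y ∈ exBoundary S) :
    (contourAt σ F ω S).CompOrd y ↔ OrdGood σ F ω y :=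
  compOrd_contourAt_iff hω hS hd hy ReflTransGen.refl

/-- **The intrinsic openness of the extracted contour agrees with the configuration on every edge of
the ball of a site of the support.** [cite: FriedliVelenik2017, §7.2.6 (ω_γ̄ and the labels determine ω near γ̄)] -/
theorem isOpen_iff_eOpen_of_mem_supp (hd : 2 ≤ d) {x : Site d} (hx : x ∈ S) {e : Sym2 (Site d)} (he : e ∈ ballEdges x) :
    (contourAt σ F ω S).IsOpen e ↔ EOpen σ F ω e := by
  have hd1 : 1 ≤ d := by omega
  obtain ⟨heE, hxe⟩ := mem_ballEdges_iff.1 he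
  rw [Contour.IsOpen, contourAt_supp]
  by_cases hin : e ∈ nnEdges S
  · -- inside the support: recorded
    simp only [contourAt, mem_filter, hin, true_and, not_true_eq_false, false_and, or_false]
  · -- an endpoint `u ∉ S`, in the ball of `x ∈ S`: `u ∈ ∂^ex S`, good, and the edge lies in its ball
    have hends : ∀ z ∈ e, z ∈ starBall x := (mem_coBall_iff.1 hxe)
    obtain ⟨u, hue, huS⟩ : ∃ u, u ∈ e ∧ u ∉ S := by
      by_contra hall
      push Not at hall
      exact hin (mem_nnEdges.2 ⟨heE, hall⟩)
    have huball : u ∈ starBall x := hends u hue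
    have hu : u ∈ exBoundary S := mem_exBoundary.2 ⟨huS, x, hx, adj_iff_mem_starBall.2 ⟨huball, fun h => huS (h ▸ hx)⟩⟩
    have hunb : ∀ z ∈ starBall u, ¬ Bad σ F ω z := fun z hz => not_bad_near_exBoundary hω hS hu hz
    have heu : e ∈ ballEdges u := by
      refine mem_ballEdges_iff.2 ⟨heE, mem_coBall_of_mem heE hue⟩
    -- the value of `e` in `ω` is the type of `u`
    have hval : EOpen σ F ω e ↔ OrdGood σ F ω u := by
      constructor
      · intro ho
        by_contra hno
        have hdis : DisGood σ F ω u := by by_contra hnd; exact hunb u (mem_starBall_self u) ⟨hno, hnd⟩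
        exact hdis e heu ho
      · intro hg; exact hg e heu
    rw [hval]
    constructor
    · rintro (h | ⟨-, u', hu'e, hu'S, hc⟩)
      · exact absurd (mem_filter.1 h).1 hin
      · -- `u'` is also an endpoint off `S` in the ball of `x`: same type as `u`
        have hu' : u' ∈ exBoundary S :=
          mem_exBoundary.2 ⟨hu'S, x, hx, adj_iff_mem_starBall.2 ⟨hends u' hu'e, fun h => hu'S (h ▸ hx)⟩⟩
        have hg' : OrdGood σ F ω u' := (compOrd_contourAt_iff_ordGood hω hS hd hu').1 hc
        -- `u` and `u'` are at distance `≤ 1` (both in `e`)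
        have hdist : supDist u' u ≤ 1 := by
          induction e using Sym2.ind with
          | h a b =>
            rw [SimpleGraph.mem_edgeSet] at heE
            have hab : supDist a b ≤ 1 := (zdStar_adj.1 (zdGraph_le_zdStar heE)).2
            rcases Sym2.mem_iff.1 hue with rfl | rfl <;> rcases Sym2.mem_iff.1 hu'e with rfl | rfl
            · simp
            · rwa [supDist_comm]
            · exact hab
            · simp
        exact ordGood_of_supDist_le_one hd1 hdist hg' (hunb u (mem_starBall_self u))
    · intro hg
      exact Or.inr ⟨hin, u, hue, huS, (compOrd_contourAt_iff_ordGood hω hS hd hu).2 hg⟩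

end Agreement

end RCC

end Literature.Probability.LatticeModels

end
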